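import Literature.AlgebraicGeometry.HodgeTheory.GysinBaseChange
import Literature.AlgebraicGeometry.HodgeTheory.AlgebraicClassesExteriorProduct
import Literature.AlgebraicGeometry.HodgeTheory.SupportedClassesOfChowZeroSupportedAboveDim
import Literature.Barriers.HodgeConjecture.DecompositionOfTheDiagonalWeil
import Literature.AlgebraicGeometry.HodgeTheory.ArapuraSurfaceFibredFourfoldsProofs
import Literature.AlgebraicGeometry.HodgeTheory.LefschetzOneOneHolds
import HarnessLib

/-!
# Route GenericDivisibility — crux C2 `GenericDivisibilityBounded` (stmt-HodgeConjecture-18467):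
# Künneth — `N¹Hᵃ(V) = Hᵃ(V)` for ONE factor forces `N¹H^{a+b}(V ⊗ V') = H^{a+b}(V ⊗ V')`

Line `finite-level-bootstrap`, lead c4 (cycle 6), registered sub-goal `stub_supportedTopOfProduct`.
Sorry-free, definition-free, Hodge-free except for the `p_g = 0` corollary (Lefschetz `(1,1)`, PROVED
in the tree). `Nʳ Hⁱ(X(ℂ); ℂ) = supportedClasses X i r` is Grothendieck's coniveau filtration with
`ℂ`-coefficients.

The lead's sector theorem (`stub_heartOfSupportedTop`) puts the heart of the line (at every prime and
every level) and the crux C2 on every smooth projective `2p`-fold `X` with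
`N¹H^{2p}(X(ℂ); ℂ) = H^{2p}(X(ℂ); ℂ)`. This file supplies such `X` as PRODUCTS:

* `genericDivisibilityBounded_cupProduct_map_fst_map_snd_mem_supportedClasses_one` — for `V`, `V'`
  smooth projective of dimensions `a`, `b` with `N¹Hᵃ(V) = Hᵃ(V)` OR `N¹Hᵇ(V') = Hᵇ(V')`, every
  Künneth generator `fst^* x ∪ snd^* y` (`x ∈ Hⁱ(V)`, `y ∈ Hʲ(V')`, `i + j = a + b`) of
  `H^{a+b}((V ⊗ V')(ℂ); ℂ)` has coniveau `≥ 1`: if `i > a = dim V` then `N¹Hⁱ(V) = Hⁱ(V)`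
  (Bloch–Srinivas with `CH₀(V)` trivially supported in dimension `≤ dim V`, the tree's
  `supportedClasses_eq_top_of_hasChowZeroSupportedInDimLE_of_lt` + `hasChowZeroSupportedInDimLE_self`),
  if `j > b` likewise for `y`, and `i = a`, `j = b` is the hypothesis; exterior products add
  coniveaux (`cupProduct_map_fst_map_snd_mem_supportedClasses`, Voisin II proof of Prop. 9.20);
* `genericDivisibilityBounded_supportedClasses_tensor_eq_top_of_or` and the registered stub
  `stub_supportedTopOfProduct` (+ its mirror `…_of_snd`, and the degree-cast form `…_of_eq`) —
  **`N¹H^{a+b}((V ⊗ V')(ℂ); ℂ) = H^{a+b}((V ⊗ V')(ℂ); ℂ)`**, since the Künneth generators span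
  (`kunnethSpan_complexBetti`, Hatcher Thm. 3.15);
* `genericDivisibilityBounded_supportedClasses_tensor_eq_top_of_pg_zero` (+ mirror) — **for a
  smooth projective surface `S` with `p_g(S) = 0` and ANY smooth projective `Y`,
  `N¹H^{2+b}((S ⊗ Y)(ℂ); ℂ) = H^{2+b}`**: `N¹H²(S) = H²(S)` by Lefschetz `(1,1)`
  (`algebraicClasses_one_eq_top_of_pg_zero lefschetzOneOne_rational_holds`). E.g. `Enriques ⊗ K3`,
  where `CH₀` is infinite-dimensional (Mumford) — outside the Bloch–Srinivas sector of
  `…SmallChowZero`, inside the `N¹ = ⊤` sector of the heart.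

References: [HatcherAT2002] §3.2 Thm. 3.15; [VoisinHodgeII2003] proof of Prop. 9.20, Thm. 10.17,
Cor. 10.21; [BlochSrinivas1983] Thm. 1 (proof); [GrothendieckTopology1969] §1; [Arapura2022] proof
of Cor. 1.5; [VoisinHodgeI2002] Thm. 11.30.
-/

set_option linter.dupNamespace false

noncomputable section

namespace Summit.HodgeConjecture.HodgeConjecture.Theorems

open CategoryTheory AlgebraicGeometry MonoidalCategory CartesianMonoidalCategory
open Literature.AlgebraicGeometry.Motives Literature.AlgebraicGeometry.HodgeTheory
  Literature.AlgebraicTopology.SingularHomology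
open Literature.Barriers.HodgeConjecture

/-! ### Above the dimension every class has coniveau `≥ 1` -/

/-- **`N¹Hˡ(V(ℂ); ℂ) = Hˡ(V(ℂ); ℂ)` for `l > dim V`** (Bloch–Srinivas with `CH₀(V)` supported in
dimension `≤ dim V`, which is vacuous: the tree's
`supportedClasses_eq_top_of_hasChowZeroSupportedInDimLE_of_lt` fed with
`hasChowZeroSupportedInDimLE_self`). [cite: BlochSrinivas1983, Thm. 1 (proof)]
[cite: VoisinHodgeII2003, Thm. 10.17 and Cor. 10.21] -/
theorem genericDivisibilityBounded_supportedClasses_one_eq_top_of_dim_lt {a : ℕ} {V : SchemeOver ℂ}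
    (hV : IsSmoothProjective a V) {l : ℕ} (hl : a < l) : supportedClasses V l 1 = ⊤ :=
  supportedClasses_eq_top_of_hasChowZeroSupportedInDimLE_of_lt hV (hasChowZeroSupportedInDimLE_self hV) hl

/-! ### The Künneth generators have coniveau `≥ 1` -/

/-- **Each Künneth generator `fst^* x ∪ snd^* y` of `H^{a+b}((V ⊗ V')(ℂ); ℂ)` has coniveau `≥ 1`**
as soon as `N¹Hᵃ(V) = Hᵃ(V)` or `N¹Hᵇ(V') = Hᵇ(V')` (`a = dim V`, `b = dim V'`, `x ∈ Hⁱ(V)`,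
`y ∈ Hʲ(V')`, `i + j = a + b`): for `i > a` the class `x` has coniveau `≥ 1` for dimension reasons,
for `i < a` one has `j > b` and `y` does, and for `i = a`, `j = b` one of them does by hypothesis; the
other factor lies in `N⁰ = everything`, and exterior products add coniveaux,
`pr_V^* N^r ∪ pr_{V'}^* N^s ⊆ N^{r+s}` (Voisin II, proof of Prop. 9.20, first display, on supports —
the tree's `cupProduct_map_fst_map_snd_mem_supportedClasses`).
[cite: VoisinHodgeII2003, proof of Prop. 9.20] [cite: GrothendieckTopology1969, §1] -/
theorem genericDivisibilityBounded_cupProduct_map_fst_map_snd_mem_supportedClasses_one {a b : ℕ}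
    {V V' : SchemeOver ℂ} (hV : IsSmoothProjective a V) (hV' : IsSmoothProjective b V')
    (h : supportedClasses V a 1 = ⊤ ∨ supportedClasses V' b 1 = ⊤) {i j : ℕ} (hij : i + j = a + b)
    (x : complexBetti V i) (y : complexBetti V' j) :
    cupProduct hij (complexBetti.map (fst V V') i x) (complexBetti.map (snd V V') j y) ∈
      supportedClasses (V ⊗ V') (a + b) 1 := by
  -- either `x ∈ N¹Hⁱ(V)` or `y ∈ N¹Hʲ(V')`
  have hxy : x ∈ supportedClasses V i 1 ∨ y ∈ supportedClasses V' j 1 := by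
    rcases lt_trichotomy i a with hi | rfl | hi
    · refine Or.inr ?_
      rw [genericDivisibilityBounded_supportedClasses_one_eq_top_of_dim_lt hV' (show b < j by omega)]
      exact Submodule.mem_top
    · obtain rfl : j = b := by omega
      rcases h with h | h
      · exact Or.inl (h ▸ Submodule.mem_top)
      · exact Or.inr (h ▸ Submodule.mem_top)
    · refine Or.inl ?_
      rw [genericDivisibilityBounded_supportedClasses_one_eq_top_of_dim_lt hV hi]
      exact Submodule.mem_top
  rcases hxy with hx | hy
  · have hy : y ∈ supportedClasses V' j 0 := by
      rw [supportedClasses_zero]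
      exact Submodule.mem_top
    exact supportedClasses_mono (V ⊗ V') (a + b) (show 1 ≤ 1 + 0 by norm_num)
      (cupProduct_map_fst_map_snd_mem_supportedClasses hV hV' hij hx hy)
  · have hx : x ∈ supportedClasses V i 0 := by
      rw [supportedClasses_zero]
      exact Submodule.mem_top
    exact supportedClasses_mono (V ⊗ V') (a + b) (show 1 ≤ 0 + 1 by norm_num)
      (cupProduct_map_fst_map_snd_mem_supportedClasses hV hV' hij hx hy)

/-! ### `N¹H^{a+b}((V ⊗ V')(ℂ); ℂ) = H^{a+b}((V ⊗ V')(ℂ); ℂ)` -/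

/-- **Künneth: if `N¹Hᵃ(V) = Hᵃ(V)` or `N¹Hᵇ(V') = Hᵇ(V')` (`a = dim V`, `b = dim V'`), then
`N¹H^{a+b}((V ⊗ V')(ℂ); ℂ) = H^{a+b}((V ⊗ V')(ℂ); ℂ)`**: the classes `fst^* x ∪ snd^* y` span
`H^{a+b}((V ⊗ V')(ℂ); ℂ)` (`kunnethSpan_complexBetti`, Hatcher Thm. 3.15 for the compact manifolds
`V(ℂ)`, `V'(ℂ)`) and each has coniveau `≥ 1`
(`genericDivisibilityBounded_cupProduct_map_fst_map_snd_mem_supportedClasses_one`).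
[cite: HatcherAT2002, §3.2 Thm. 3.15] [cite: VoisinHodgeII2003, proof of Prop. 9.20] -/
theorem genericDivisibilityBounded_supportedClasses_tensor_eq_top_of_or {a b : ℕ}
    {V V' : SchemeOver ℂ} (hV : IsSmoothProjective a V) (hV' : IsSmoothProjective b V')
    (h : supportedClasses V a 1 = ⊤ ∨ supportedClasses V' b 1 = ⊤) :
    supportedClasses (V ⊗ V') (a + b) 1 = ⊤ := by
  refine eq_top_iff.2 fun z _ ↦ Submodule.span_le.2 ?_ (kunnethSpan_complexBetti hV hV' (a + b) z)
  rintro _ ⟨i, j, hij, x, y, rfl⟩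
  exact genericDivisibilityBounded_cupProduct_map_fst_map_snd_mem_supportedClasses_one hV hV' h hij x y

/-- **Registered sub-goal `stub_supportedTopOfProduct` of the crux item (lead c4): Künneth — if the
FIRST factor has all of its top-degree cohomology of coniveau `≥ 1`, `N¹Hᵃ(V(ℂ); ℂ) = Hᵃ(V(ℂ); ℂ)`
(`a = dim V`), then so does the product in total degree `a + b` (`b = dim V'`):
`N¹H^{a+b}((V ⊗ V')(ℂ); ℂ) = H^{a+b}((V ⊗ V')(ℂ); ℂ)`.**
[cite: HatcherAT2002, §3.2 Thm. 3.15] [cite: VoisinHodgeII2003, proof of Prop. 9.20] -/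
theorem stub_supportedTopOfProduct : ∀ ⦃a b : ℕ⦄ ⦃V V' : SchemeOver ℂ⦄, IsSmoothProjective a V → IsSmoothProjective b V' → supportedClasses V a 1 = ⊤ → supportedClasses (V ⊗ V') (a + b) 1 = ⊤ :=
  fun _ _ _ _ hV hV' h ↦ genericDivisibilityBounded_supportedClasses_tensor_eq_top_of_or hV hV' (Or.inl h)

/-- **The mirror statement**: if the SECOND factor has `N¹Hᵇ(V'(ℂ); ℂ) = Hᵇ(V'(ℂ); ℂ)` (`b = dim V'`),
then `N¹H^{a+b}((V ⊗ V')(ℂ); ℂ) = H^{a+b}((V ⊗ V')(ℂ); ℂ)`.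
[cite: HatcherAT2002, §3.2 Thm. 3.15] [cite: VoisinHodgeII2003, proof of Prop. 9.20] -/
theorem genericDivisibilityBounded_supportedClasses_tensor_eq_top_of_snd {a b : ℕ}
    {V V' : SchemeOver ℂ} (hV : IsSmoothProjective a V) (hV' : IsSmoothProjective b V')
    (h : supportedClasses V' b 1 = ⊤) : supportedClasses (V ⊗ V') (a + b) 1 = ⊤ :=
  genericDivisibilityBounded_supportedClasses_tensor_eq_top_of_or hV hV' (Or.inr h)

/-- **Degree-cast form** (for use at `k = 2p = a + b` without transporting `⊤` along `a + b = k`):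
`N¹Hᵏ((V ⊗ V')(ℂ); ℂ) = Hᵏ` whenever `a + b = k` and one factor has its top-degree cohomology of
coniveau `≥ 1`. [cite: HatcherAT2002, §3.2 Thm. 3.15] [cite: VoisinHodgeII2003, proof of Prop. 9.20] -/
theorem genericDivisibilityBounded_supportedClasses_tensor_eq_top_of_eq {a b k : ℕ}
    {V V' : SchemeOver ℂ} (hV : IsSmoothProjective a V) (hV' : IsSmoothProjective b V')
    (h : supportedClasses V a 1 = ⊤ ∨ supportedClasses V' b 1 = ⊤) (hk : a + b = k) :
    supportedClasses (V ⊗ V') k 1 = ⊤ := by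
  subst hk
  exact genericDivisibilityBounded_supportedClasses_tensor_eq_top_of_or hV hV' h

/-! ### Surfaces with `p_g = 0` times anything -/

/-- **On a smooth projective surface `S` with `p_g(S) = 0`, `N¹H²(S(ℂ); ℂ) = H²(S(ℂ); ℂ)`**: the
divisor classes span `H²` by Lefschetz `(1,1)` (PROVED in the tree, `lefschetzOneOne_rational_holds`)
and `span_ℂ H²(S; ℚ) = H²(S; ℂ)` — the tree's `algebraicClasses_one_eq_top_of_pg_zero`, read through
`algebraicClasses S 1 = N¹H^{2·1}`. [cite: Arapura2022, proof of Cor. 1.5 (p. 5)]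
[cite: VoisinHodgeI2002, Thm. 11.30] -/
theorem genericDivisibilityBounded_supportedClasses_two_one_eq_top_of_pg_zero {S : SchemeOver ℂ}
    (hS : IsSmoothProjective 2 S)
    (hpg : ∃ A : HodgeModel 2 S, Module.finrank ℂ ↥(A.hodgePQ 2 2 0) = 0) :
    supportedClasses S 2 1 = ⊤ :=
  algebraicClasses_one_eq_top_of_pg_zero lefschetzOneOne_rational_holds hS hpg

/-- **`N¹H^{2+b}((S ⊗ Y)(ℂ); ℂ) = H^{2+b}((S ⊗ Y)(ℂ); ℂ)` for a smooth projective surface `S` with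
`p_g(S) = 0` and ANY smooth projective `Y` of dimension `b`** (e.g. `Enriques ⊗ K3`, whose `CH₀` is
infinite-dimensional): Künneth (`stub_supportedTopOfProduct`) with `N¹H²(S) = H²(S)`
(Lefschetz `(1,1)`). With the lead's `stub_heartOfSupportedTop` this puts the heart of line
`finite-level-bootstrap` and the crux C2 on every such `2p`-fold `S ⊗ Y`.
[cite: HatcherAT2002, §3.2 Thm. 3.15] [cite: Arapura2022, proof of Cor. 1.5 (p. 5)] -/
theorem genericDivisibilityBounded_supportedClasses_tensor_eq_top_of_pg_zero {b : ℕ}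
    {S Y : SchemeOver ℂ} (hS : IsSmoothProjective 2 S)
    (hpg : ∃ A : HodgeModel 2 S, Module.finrank ℂ ↥(A.hodgePQ 2 2 0) = 0)
    (hY : IsSmoothProjective b Y) : supportedClasses (S ⊗ Y) (2 + b) 1 = ⊤ :=
  stub_supportedTopOfProduct hS hY
    (genericDivisibilityBounded_supportedClasses_two_one_eq_top_of_pg_zero hS hpg)

/-- **Mirror: `N¹H^{b+2}((Y ⊗ S)(ℂ); ℂ) = H^{b+2}((Y ⊗ S)(ℂ); ℂ)`** for `Y` smooth projective of
dimension `b` and `S` a smooth projective surface with `p_g(S) = 0`.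
[cite: HatcherAT2002, §3.2 Thm. 3.15] [cite: Arapura2022, proof of Cor. 1.5 (p. 5)] -/
theorem genericDivisibilityBounded_supportedClasses_tensor_eq_top_of_pg_zero' {b : ℕ}
    {S Y : SchemeOver ℂ} (hY : IsSmoothProjective b Y) (hS : IsSmoothProjective 2 S)
    (hpg : ∃ A : HodgeModel 2 S, Module.finrank ℂ ↥(A.hodgePQ 2 2 0) = 0) :
    supportedClasses (Y ⊗ S) (b + 2) 1 = ⊤ :=
  genericDivisibilityBounded_supportedClasses_tensor_eq_top_of_snd hY hS
    (genericDivisibilityBounded_supportedClasses_two_one_eq_top_of_pg_zero hS hpg)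

/-- **Degree-cast form at `2p`**: for `p ≥ 1`, a smooth projective surface `S` with `p_g(S) = 0` and
`Y` smooth projective of dimension `2p - 2`, `N¹H^{2p}((S ⊗ Y)(ℂ); ℂ) = H^{2p}((S ⊗ Y)(ℂ); ℂ)` — the
shape consumed by the `N¹ = ⊤` sector of the crux C2 and of the heart of the line.
[cite: HatcherAT2002, §3.2 Thm. 3.15] [cite: Arapura2022, proof of Cor. 1.5 (p. 5)] -/
theorem genericDivisibilityBounded_supportedClasses_tensor_two_mul_eq_top_of_pg_zero {p : ℕ}
    (hp : 1 ≤ p) {S Y : SchemeOver ℂ} (hS : IsSmoothProjective 2 S)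
    (hpg : ∃ A : HodgeModel 2 S, Module.finrank ℂ ↥(A.hodgePQ 2 2 0) = 0)
    (hY : IsSmoothProjective (2 * p - 2) Y) : supportedClasses (S ⊗ Y) (2 * p) 1 = ⊤ :=
  genericDivisibilityBounded_supportedClasses_tensor_eq_top_of_eq hS hY
    (Or.inl (genericDivisibilityBounded_supportedClasses_two_one_eq_top_of_pg_zero hS hpg)) (by omega)

end Summit.HodgeConjecture.HodgeConjecture.Theorems

end
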